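import Literature.NumberTheory.GaloisRepresentations.ContinuousCorestriction
import Literature.NumberTheory.EllipticCurves.SubgroupSelmer
import HarnessLib

/-!
# D7-u, file A: the refined cochain data `(z, η)` behind the unramified local condition at a bad
# place, and the EXTRACTION LEMMA (route W2 = `KimAtThreeKolyvagin`, crux 19560 (C3) / TamDiv∞;
# seat `bsd-addord-w2-tamdiv`)

Pure continuous-cochain algebra for a topological group `G`, an open normal subgroup `U`
(intended: `Gal(ℚ̄/ℚ(μ_r))`), a "decomposition" subgroup `D` with an "inertia" subgroup `I`
normalised by `D` and with ALL conjugates `g I g⁻¹ ≤ U` (the place is unramified in the level),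
a coefficient representation `X` (intended: `E[M]`) and a submodule `B ≤ X` (intended:
`red(T^{I})`, the unramified values) fixed pointwise by `I` and stable under `D`.

A REFINED DATUM is a pair `(z, η)`: a continuous crossed homomorphism `z : U → X` together with a
function `η : G → X` (local trivialisations at the primes `g·w̃`, `g ∈ G`).  No definition is
introduced; the four conditions are spelled out where used:
* (N)  `(z, η)` is NULL: `z = dα` and `η_g ≡ g⁻¹ α (mod B)` for some `α ∈ X`;
* (C1) `η_{u g} − η_g − g⁻¹ z(u⁻¹) ∈ B` for `u ∈ U`;
* (C2) `η_{g δ} − δ⁻¹ η_g ∈ B` for `δ ∈ D`;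
* (L_g) `g⁻¹ z(g δ g⁻¹) − (δ η_g − η_g) ∈ B` for `δ ∈ D` with `g δ g⁻¹ ∈ U`, and `= 0` for `δ ∈ I`.
`G` acts by `g₀ · (z, η) = (g₀ · z, g ↦ η_{g₀⁻¹ g})` (`g₀ · z` = the tree's conjugation of
cocycles, `contOneCocycles.pullback (subgroupConj U g₀) (conjRepHom X U g₀)`).

Results: the conditions are linear and stable under the action; null data satisfy them; **`U`
acts trivially modulo null data on (C1)-data** (`exists_null_conj_sub_of_C1`); and the
**EXTRACTION LEMMA** (`apply_sub_mem_of_fixed`, `apply_eq_of_L`): if `z = Φ|_U` for a global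
crossed homomorphism `Φ`, `X^U = 0`, (C2) holds, and `δ · (z, η) − (z, η)` is null for every
`δ ∈ D`, then `Φ(δ) − (δ η_1 − η_1) ∈ B` for all `δ ∈ D`; with (L_1), `Φ(τ) = τ η_1 − η_1` on `I`.
That is: `Φ − dη_1` is a `B`-valued cocycle on `D` vanishing on `I` — the cochain form of
"`loc_w κ ∈ H¹_{𝓕_u}`" ([MR04] Remark A.5).  This file is the algebraic heart of the descent that
proves [Ru00] Thm. 4.5.1 at the RAMIFIED primes (see the seat memo W2-TAMDIV-D7U-DESCENT-g0.md):
Kolyvagin's invariance argument is run on these data instead of on `H¹(U, X)`.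

References: B. Mazur, K. Rubin, *Kolyvagin systems*, Mem. AMS 799 (2004), App. A, Remark A.5;
K. Rubin, *Euler Systems* (2000), Thm. 4.5.1, §4.6; J. Nekovář, *Selmer complexes*, Astérisque 310
(2006), §6–§7 (Selmer complexes with unramified local conditions; this file is an explicit
degree-`1` cochain model).
-/

set_option autoImplicit false
-- the Theorems namespace of a single-conjunct summit repeats the summit name by design (D-0017)
set_option linter.dupNamespace false

noncomputable section

open CategoryTheory Function Finset
open Literature.NumberTheory.GaloisRepresentations
open Literature.NumberTheory.EllipticCurves (subgroupConj subgroupConj_apply_coe)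

universe u v

namespace Summit.BirchSwinnertonDyer.BirchSwinnertonDyer.Theorems.KimAtThreeD7uRefined

variable {R : Type v} [CommRing R] [TopologicalSpace R]
variable {G : Type u} [Group G] [TopologicalSpace G] [IsTopologicalGroup G]
variable (X : TopRep.{u} R G) (U : Subgroup G) [U.Normal]

/-- Local notation: `𝔠⟦g⟧ z` = the conjugate cocycle `x ↦ g • z(g⁻¹ x g)` on `U`. -/
local notation3 "𝔠⟦" g "⟧" => contOneCocycles.pullback (subgroupConj U g) (conjRepHom X U g)

/-! ### §1 The conjugation action on cocycles of `U` (cocycle level) -/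

/-- Values of the conjugate cocycle: `(g · z)(x) = g • z(g⁻¹ x g)`. [folklore] -/
theorem conj_apply (g : G) (z : contOneCocycles (subgroupRep X U)) (x : U) :
    (𝔠⟦g⟧ z).1 x = X.ρ g (z.1 ⟨g⁻¹ * x * g, (subgroupConj U g x).2⟩) := rfl

/-- The action is additive in the cocycle. [folklore] -/
theorem conj_add (g : G) (z z' : contOneCocycles (subgroupRep X U)) :
    𝔠⟦g⟧ (z + z') = 𝔠⟦g⟧ z + 𝔠⟦g⟧ z' := by
  apply Subtype.ext; ext x
  change X.ρ g ((z + z').1 (subgroupConj U g x)) = X.ρ g (z.1 _) + X.ρ g (z'.1 _)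
  rw [Submodule.coe_add, ContinuousMap.add_apply, map_add]
  rfl

/-- The action commutes with subtraction. [folklore] -/
theorem conj_sub (g : G) (z z' : contOneCocycles (subgroupRep X U)) :
    𝔠⟦g⟧ (z - z') = 𝔠⟦g⟧ z - 𝔠⟦g⟧ z' := by
  apply Subtype.ext; ext x
  change X.ρ g ((z - z').1 (subgroupConj U g x)) = X.ρ g (z.1 _) - X.ρ g (z'.1 _)
  rw [Submodule.coe_sub, ContinuousMap.sub_apply, map_sub]
  rfl

/-- The action is `R`-linear in the cocycle. [folklore] -/
theorem conj_smul (g : G) (a : R) (z : contOneCocycles (subgroupRep X U)) :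
    𝔠⟦g⟧ (a • z) = a • 𝔠⟦g⟧ z := by
  apply Subtype.ext; ext x
  change X.ρ g ((a • z).1 (subgroupConj U g x)) = a • X.ρ g (z.1 _)
  rw [Submodule.coe_smul, ContinuousMap.smul_apply, map_smul]
  rfl

/-- The action is a (left) action: `(g h) · z = g · (h · z)`. [folklore] -/
theorem conj_mul (g h : G) (z : contOneCocycles (subgroupRep X U)) :
    𝔠⟦g * h⟧ z = 𝔠⟦g⟧ (𝔠⟦h⟧ z) := by
  apply Subtype.ext; ext x
  rw [conj_apply, conj_apply, conj_apply, ← ρ_mul_apply]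
  congr 2
  apply Subtype.ext
  simp only [mul_inv_rev, mul_assoc]

/-- An element `u ∈ U` acts on a cocycle of `U` by adding the coboundary of `z(u)`:
`(u · z)(x) = z(x) + (x • z(u) − z(u))`. [folklore] -/
theorem conj_apply_of_mem {u : G} (hu : u ∈ U) (z : contOneCocycles (subgroupRep X U)) (x : U) :
    (𝔠⟦u⟧ z).1 x = z.1 x + (X.ρ (x : G) (z.1 ⟨u, hu⟩) - z.1 ⟨u, hu⟩) := by
  rw [conj_apply]
  -- `z(u⁻¹ x u) = z(u⁻¹) + u⁻¹ • (z(x) + x • z(u))`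
  have e : (⟨u⁻¹ * x * u, (subgroupConj U u x).2⟩ : U) = ⟨u, hu⟩⁻¹ * (x * ⟨u, hu⟩) :=
    Subtype.ext (by simp [mul_assoc])
  rw [e, z.2, z.2, subgroup_cocycle_inv X U z ⟨u, hu⟩]
  simp only [ContRepresentation.restrict_apply_apply, Subgroup.coe_subtype, Subgroup.coe_inv,
    map_add, map_neg, ← ρ_mul_apply, mul_inv_cancel, mul_inv_cancel_left, map_one,
    one_apply_eq_self]
  abel


/-! ### §2 Null data -/

section Null

variable (B : Submodule R X) (D I : Subgroup G)

omit [IsTopologicalGroup G] [U.Normal] in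
/-- Null data satisfy (C1): if `z = dα` and `η_g ≡ g⁻¹ α (mod B)` then
`η_{ug} − η_g − g⁻¹ z(u⁻¹) ∈ B`. [folklore] -/
theorem C1_of_null (z : contOneCocycles (subgroupRep X U)) (η : G → X) (α : X)
    (hz : ∀ x : U, z.1 x = X.ρ (x : G) α - α) (hη : ∀ g, η g - X.ρ g⁻¹ α ∈ B)
    (u : G) (hu : u ∈ U) (g : G) :
    η (u * g) - η g - X.ρ g⁻¹ (z.1 ⟨u⁻¹, U.inv_mem hu⟩) ∈ B := by
  have h1 := hη (u * g)
  have h2 := hη g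
  have e : η (u * g) - η g - X.ρ g⁻¹ (z.1 ⟨u⁻¹, U.inv_mem hu⟩) =
      (η (u * g) - X.ρ (u * g)⁻¹ α) - (η g - X.ρ g⁻¹ α) := by
    rw [hz, Subgroup.coe_mk, map_sub, ← ρ_mul_apply, mul_inv_rev]
    abel
  rw [e]
  exact B.sub_mem h1 h2

omit [TopologicalSpace G] [IsTopologicalGroup G] [U.Normal] in
/-- Null data satisfy (C2): `η_{gδ} − δ⁻¹ η_g ∈ B` (uses `D`-stability of `B`). [folklore] -/
theorem C2_of_null (hBD : ∀ δ ∈ D, ∀ b ∈ B, X.ρ δ b ∈ B) (η : G → X) (α : X)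
    (hη : ∀ g, η g - X.ρ g⁻¹ α ∈ B) (g δ : G) (hδ : δ ∈ D) :
    η (g * δ) - X.ρ δ⁻¹ (η g) ∈ B := by
  have h1 := hη (g * δ)
  have h2 := hBD δ⁻¹ (D.inv_mem hδ) _ (hη g)
  have e : η (g * δ) - X.ρ δ⁻¹ (η g) =
      (η (g * δ) - X.ρ (g * δ)⁻¹ α) - X.ρ δ⁻¹ (η g - X.ρ g⁻¹ α) := by
    rw [map_sub, ← ρ_mul_apply, mul_inv_rev]
    abel
  rw [e]
  exact B.sub_mem h1 h2

omit [IsTopologicalGroup G] [U.Normal] in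
/-- Null data satisfy the `B`-part of (L_g): `g⁻¹ z(gδg⁻¹) − (δ η_g − η_g) ∈ B`. [folklore] -/
theorem L_mem_of_null (hBD : ∀ δ ∈ D, ∀ b ∈ B, X.ρ δ b ∈ B)
    (z : contOneCocycles (subgroupRep X U)) (η : G → X) (α : X)
    (hz : ∀ x : U, z.1 x = X.ρ (x : G) α - α) (hη : ∀ g, η g - X.ρ g⁻¹ α ∈ B)
    (g δ : G) (hδ : δ ∈ D) (hgδ : g * δ * g⁻¹ ∈ U) :
    X.ρ g⁻¹ (z.1 ⟨g * δ * g⁻¹, hgδ⟩) - (X.ρ δ (η g) - η g) ∈ B := by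
  have h1 := hη g
  have h2 := hBD δ hδ _ (hη g)
  have e : X.ρ g⁻¹ (z.1 ⟨g * δ * g⁻¹, hgδ⟩) - (X.ρ δ (η g) - η g) =
      (η g - X.ρ g⁻¹ α) - X.ρ δ (η g - X.ρ g⁻¹ α) := by
    rw [hz, Subgroup.coe_mk, map_sub, map_sub, ← ρ_mul_apply, ← ρ_mul_apply, ← mul_assoc,
      ← mul_assoc, inv_mul_cancel, one_mul]
    abel
  rw [e]
  exact B.sub_mem h1 h2

omit [IsTopologicalGroup G] [U.Normal] in
/-- Null data satisfy the `I`-part of (L_g): `g⁻¹ z(gτg⁻¹) = τ η_g − η_g` for `τ ∈ I` (uses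
that `I` fixes `B` pointwise). [folklore] -/
theorem L_eq_of_null (hBI : ∀ τ ∈ I, ∀ b ∈ B, X.ρ τ b = b)
    (z : contOneCocycles (subgroupRep X U)) (η : G → X) (α : X)
    (hz : ∀ x : U, z.1 x = X.ρ (x : G) α - α) (hη : ∀ g, η g - X.ρ g⁻¹ α ∈ B)
    (g τ : G) (hτ : τ ∈ I) (hgτ : g * τ * g⁻¹ ∈ U) :
    X.ρ g⁻¹ (z.1 ⟨g * τ * g⁻¹, hgτ⟩) - (X.ρ τ (η g) - η g) = 0 := by
  have h2 := hBI τ hτ _ (hη g)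
  rw [map_sub] at h2
  have e : X.ρ g⁻¹ (z.1 ⟨g * τ * g⁻¹, hgτ⟩) - (X.ρ τ (η g) - η g) =
      (η g - X.ρ g⁻¹ α) - (X.ρ τ (η g) - X.ρ τ (X.ρ g⁻¹ α)) := by
    rw [hz, Subgroup.coe_mk, map_sub, ← ρ_mul_apply, ← ρ_mul_apply, ← mul_assoc,
      ← mul_assoc, inv_mul_cancel, one_mul]
    abel
  rw [e, h2, sub_self]

end Null


/-! ### §3 The conditions (C1), (C2), (L) are linear and stable under the action; null data too -/

section Conditions

variable (B : Submodule R X) (D I : Subgroup G)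

/-- (C1) is stable under the action `g₀ · (z, η) = (g₀ · z, η(g₀⁻¹ ·))` (`U` is normal). [folklore] -/
theorem C1_act (z : contOneCocycles (subgroupRep X U)) (η : G → X)
    (h : ∀ (u : G) (hu : u ∈ U) (g : G), η (u * g) - η g - X.ρ g⁻¹ (z.1 ⟨u⁻¹, U.inv_mem hu⟩) ∈ B)
    (g₀ : G) (u : G) (hu : u ∈ U) (g : G) :
    η (g₀⁻¹ * (u * g)) - η (g₀⁻¹ * g) - X.ρ g⁻¹ ((𝔠⟦g₀⟧ z).1 ⟨u⁻¹, U.inv_mem hu⟩) ∈ B := by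
  have hu' : g₀⁻¹ * u * g₀ ∈ U := by
    have := ‹U.Normal›.conj_mem u hu g₀⁻¹
    rwa [inv_inv] at this
  have key := h (g₀⁻¹ * u * g₀) hu' (g₀⁻¹ * g)
  have e1 : g₀⁻¹ * u * g₀ * (g₀⁻¹ * g) = g₀⁻¹ * (u * g) := by group
  have e2 : X.ρ (g₀⁻¹ * g)⁻¹ (z.1 ⟨(g₀⁻¹ * u * g₀)⁻¹, U.inv_mem hu'⟩) =
      X.ρ g⁻¹ ((𝔠⟦g₀⟧ z).1 ⟨u⁻¹, U.inv_mem hu⟩) := by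
    rw [conj_apply, ← ρ_mul_apply, mul_inv_rev, inv_inv]
    congr 2
    apply Subtype.ext
    simp only [mul_inv_rev, inv_inv, mul_assoc]
  rw [e1, e2] at key
  exact key

omit [TopologicalSpace G] [IsTopologicalGroup G] [U.Normal] in
/-- (C2) is stable under the action. [folklore] -/
theorem C2_act (η : G → X) (h : ∀ (g δ : G), δ ∈ D → η (g * δ) - X.ρ δ⁻¹ (η g) ∈ B)
    (g₀ : G) (g δ : G) (hδ : δ ∈ D) :
    η (g₀⁻¹ * (g * δ)) - X.ρ δ⁻¹ (η (g₀⁻¹ * g)) ∈ B := by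
  rw [← mul_assoc]
  exact h _ δ hδ

/-- The `B`-part of (L) is stable under the action: condition (L_g) for `g₀ · (z, η)` is
condition (L_{g₀⁻¹ g}) for `(z, η)`. [folklore] -/
theorem L_mem_act (z : contOneCocycles (subgroupRep X U)) (η : G → X)
    (h : ∀ (g δ : G), δ ∈ D → ∀ (hgδ : g * δ * g⁻¹ ∈ U),
      X.ρ g⁻¹ (z.1 ⟨g * δ * g⁻¹, hgδ⟩) - (X.ρ δ (η g) - η g) ∈ B)
    (g₀ : G) (g δ : G) (hδ : δ ∈ D) (hgδ : g * δ * g⁻¹ ∈ U) :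
    X.ρ g⁻¹ ((𝔠⟦g₀⟧ z).1 ⟨g * δ * g⁻¹, hgδ⟩) - (X.ρ δ (η (g₀⁻¹ * g)) - η (g₀⁻¹ * g)) ∈ B := by
  have hgδ' : g₀⁻¹ * g * δ * (g₀⁻¹ * g)⁻¹ ∈ U := by
    have := ‹U.Normal›.conj_mem _ hgδ g₀⁻¹
    rw [inv_inv] at this
    convert this using 1
    group
  have key := h (g₀⁻¹ * g) δ hδ hgδ'
  have e : X.ρ (g₀⁻¹ * g)⁻¹ (z.1 ⟨g₀⁻¹ * g * δ * (g₀⁻¹ * g)⁻¹, hgδ'⟩) =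
      X.ρ g⁻¹ ((𝔠⟦g₀⟧ z).1 ⟨g * δ * g⁻¹, hgδ⟩) := by
    rw [conj_apply, ← ρ_mul_apply]
    congr 1
    · rw [mul_inv_rev, inv_inv]
    · exact congrArg _ (Subtype.ext (by change _ = g₀⁻¹ * _ * g₀; group))
  rw [e] at key
  exact key

/-- The `I`-part of (L) is stable under the action. [folklore] -/
theorem L_eq_act (hIU : ∀ (g τ : G), τ ∈ I → g * τ * g⁻¹ ∈ U)
    (z : contOneCocycles (subgroupRep X U)) (η : G → X)
    (h : ∀ (g τ : G) (hτ : τ ∈ I),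
      X.ρ g⁻¹ (z.1 ⟨g * τ * g⁻¹, hIU g τ hτ⟩) - (X.ρ τ (η g) - η g) = 0)
    (g₀ : G) (g τ : G) (hτ : τ ∈ I) :
    X.ρ g⁻¹ ((𝔠⟦g₀⟧ z).1 ⟨g * τ * g⁻¹, hIU g τ hτ⟩) - (X.ρ τ (η (g₀⁻¹ * g)) - η (g₀⁻¹ * g)) = 0 := by
  have key := h (g₀⁻¹ * g) τ hτ
  have e : X.ρ (g₀⁻¹ * g)⁻¹ (z.1 ⟨g₀⁻¹ * g * τ * (g₀⁻¹ * g)⁻¹, hIU _ τ hτ⟩) =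
      X.ρ g⁻¹ ((𝔠⟦g₀⟧ z).1 ⟨g * τ * g⁻¹, hIU g τ hτ⟩) := by
    rw [conj_apply, ← ρ_mul_apply]
    congr 1
    · rw [mul_inv_rev, inv_inv]
    · exact congrArg _ (Subtype.ext (by change _ = g₀⁻¹ * _ * g₀; group))
  rw [e] at key
  exact key

/-- Null data are stable under the action: `g₀ · (dα, η) = (d(g₀ α), η(g₀⁻¹ ·))` with
`η(g₀⁻¹ g) ≡ g⁻¹ (g₀ α)`. [folklore] -/
theorem null_act (z : contOneCocycles (subgroupRep X U)) (η : G → X) (α : X)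
    (hz : ∀ x : U, z.1 x = X.ρ (x : G) α - α) (hη : ∀ g, η g - X.ρ g⁻¹ α ∈ B) (g₀ : G) :
    (∀ x : U, (𝔠⟦g₀⟧ z).1 x = X.ρ (x : G) (X.ρ g₀ α) - X.ρ g₀ α) ∧
      ∀ g, η (g₀⁻¹ * g) - X.ρ g⁻¹ (X.ρ g₀ α) ∈ B := by
  refine ⟨fun x => ?_, fun g => ?_⟩
  · rw [conj_apply, hz, Subgroup.coe_mk, map_sub, ← ρ_mul_apply, ← ρ_mul_apply]
    have e : g₀ * (g₀⁻¹ * (x : G) * g₀) = (x : G) * g₀ := by group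
    rw [e]
  · have h := hη (g₀⁻¹ * g)
    rwa [mul_inv_rev, inv_inv, ρ_mul_apply] at h

/-- **`U` acts trivially modulo null data on (C1)-data**: for `u ∈ U`,
`u · (z, η) − (z, η) = (d(z(u)), η(u⁻¹ ·) − η)` is null with `α = z(u)`. [folklore] -/
theorem null_conj_sub_of_C1 (z : contOneCocycles (subgroupRep X U)) (η : G → X)
    (h : ∀ (u : G) (hu : u ∈ U) (g : G), η (u * g) - η g - X.ρ g⁻¹ (z.1 ⟨u⁻¹, U.inv_mem hu⟩) ∈ B)
    (u : G) (hu : u ∈ U) :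
    (∀ x : U, (𝔠⟦u⟧ z - z).1 x = X.ρ (x : G) (z.1 ⟨u, hu⟩) - z.1 ⟨u, hu⟩) ∧
      ∀ g, (η (u⁻¹ * g) - η g) - X.ρ g⁻¹ (z.1 ⟨u, hu⟩) ∈ B := by
  refine ⟨fun x => ?_, fun g => ?_⟩
  · rw [Submodule.coe_sub, ContinuousMap.sub_apply, conj_apply_of_mem X U hu]
    abel
  · have key := h u⁻¹ (U.inv_mem hu) g
    have e : (⟨u⁻¹⁻¹, U.inv_mem (U.inv_mem hu)⟩ : U) = ⟨u, hu⟩ := Subtype.ext (inv_inv u)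
    rwa [e] at key

end Conditions

/-! ### §4 The extraction lemma -/

section Extraction

variable (B : Submodule R X) (D I : Subgroup G)

/-- **EXTRACTION LEMMA (values on `D`).**  Let `Φ : G → X` be a continuous crossed homomorphism
(a representative of the derivative class `κ`), `z = Φ|_U`, and `η : G → X` such that
* `X^U = 0` (`h0`),
* (C2) at `g = 1`: `η_δ − δ⁻¹ η_1 ∈ B` for `δ ∈ D`,
* `δ · (z, η) − (z, η)` is NULL for every `δ ∈ D` (the refined invariance).
Then `Φ(δ) − (δ η_1 − η_1) ∈ B` for every `δ ∈ D`: the cocycle `Φ − dη_1` is `B`-valued on `D`.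
Proof: the null witness `α` for `δ` has `dα = δ·z − z = d(Φ δ)` on `U`, so `α = Φ(δ)` by `h0`;
the `η`-clause at `g = 1` and (C2) at `δ⁻¹` give the claim. [cite: MazurRubin2004, App. A Remark A.5] -/
theorem apply_sub_mem_of_fixed (Φ : contOneCocycles X) (η : G → X)
    (h0 : ∀ v : X, (∀ u ∈ U, X.ρ u v = v) → v = 0)
    (hC2 : ∀ δ ∈ D, η δ - X.ρ δ⁻¹ (η 1) ∈ B)
    (hfix : ∀ δ ∈ D, ∃ α : X,
      (∀ x : U, (𝔠⟦δ⟧ (contOneCocycles.pullback (subgroupSubtypeHom U) (Y := subgroupRep X U)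
          (TopRep.ofHom ⟨ContinuousLinearMap.id R X, fun _ => rfl⟩) Φ) -
        contOneCocycles.pullback (subgroupSubtypeHom U) (Y := subgroupRep X U)
          (TopRep.ofHom ⟨ContinuousLinearMap.id R X, fun _ => rfl⟩) Φ).1 x = X.ρ (x : G) α - α) ∧
      ∀ g, (η (δ⁻¹ * g) - η g) - X.ρ g⁻¹ α ∈ B)
    (δ : G) (hδ : δ ∈ D) :
    Φ.1 δ - (X.ρ δ (η 1) - η 1) ∈ B := by
  obtain ⟨α, hα, hηα⟩ := hfix δ hδ
  -- `α = Φ δ`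
  have hαΦ : α = Φ.1 δ := by
    rw [← sub_eq_zero]
    refine h0 _ fun u hu => ?_
    have h1 := hα ⟨u, hu⟩
    rw [Submodule.coe_sub, ContinuousMap.sub_apply, conj_apply, contOneCocycles.pullback_apply,
      contOneCocycles.pullback_apply] at h1
    change X.ρ δ (Φ.1 (δ⁻¹ * u * δ)) - Φ.1 u = X.ρ u α - α at h1
    -- `δ • Φ(δ⁻¹ u δ) = Φ u + (u • Φ δ - Φ δ)` (cocycle identities on `G`)
    have h2 : X.ρ δ (Φ.1 (δ⁻¹ * u * δ)) = Φ.1 u + (X.ρ u (Φ.1 δ) - Φ.1 δ) := by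
      have hc := Φ.2 δ (δ⁻¹ * u * δ)
      rw [show δ * (δ⁻¹ * u * δ) = u * δ by group, Φ.2 u δ] at hc
      -- hc : Φ u + u • Φ δ = Φ δ + δ • Φ (δ⁻¹ u δ)
      rw [← sub_eq_iff_eq_add'] at hc
      rw [← hc]
      abel
    rw [h2] at h1
    rw [map_sub]
    have h3 : X.ρ u (Φ.1 δ) - Φ.1 δ = X.ρ u α - α := by
      have := h1; rw [add_sub_cancel_left] at this; exact this
    -- from `u Φδ − Φδ = u α − α`
    rw [sub_eq_sub_iff_sub_eq_sub] at h3
    have h4 : X.ρ u α - X.ρ u (Φ.1 δ) = -(X.ρ u (Φ.1 δ) - X.ρ u α) := by abel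
    rw [h4, h3]
    abel
  subst hαΦ
  have h1 := hηα 1
  rw [mul_one, inv_one, map_one, one_apply_eq_self] at h1
  have h2 := hC2 δ⁻¹ (D.inv_mem hδ)
  rw [inv_inv] at h2
  -- h1 : η δ⁻¹ - η 1 - Φ δ ∈ B ;  h2 : η δ⁻¹ - δ (η 1) ∈ B
  have e : Φ.1 δ - (X.ρ δ (η 1) - η 1) = (η δ⁻¹ - X.ρ δ (η 1)) - (η δ⁻¹ - η 1 - Φ.1 δ) := by abel
  rw [e]
  exact B.sub_mem h2 h1

omit [IsTopologicalGroup G] [U.Normal] in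
/-- **EXTRACTION LEMMA (values on `I`).**  With `z = Φ|_U` and the `I`-part of (L_1) (`I ≤ U`),
`Φ(τ) = τ η_1 − η_1` for every `τ ∈ I`: the cocycle `Φ − dη_1` vanishes on `I`. [folklore] -/
theorem apply_eq_of_L (Φ : contOneCocycles X) (η : G → X) (hIU1 : ∀ τ ∈ I, τ ∈ U)
    (hL : ∀ (τ : G) (hτ : τ ∈ I), ∀ (h : 1 * τ * 1⁻¹ ∈ U),
      X.ρ 1⁻¹ ((contOneCocycles.pullback (subgroupSubtypeHom U) (Y := subgroupRep X U)
        (TopRep.ofHom ⟨ContinuousLinearMap.id R X, fun _ => rfl⟩) Φ).1 ⟨1 * τ * 1⁻¹, h⟩) -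
        (X.ρ τ (η 1) - η 1) = 0)
    (τ : G) (hτ : τ ∈ I) : Φ.1 τ = X.ρ τ (η 1) - η 1 := by
  have hmem : 1 * τ * 1⁻¹ ∈ U := by simpa using hIU1 τ hτ
  have h := hL τ hτ hmem
  have e1 : (contOneCocycles.pullback (subgroupSubtypeHom U) (Y := subgroupRep X U)
      (TopRep.ofHom ⟨ContinuousLinearMap.id R X, fun _ => rfl⟩) Φ).1 ⟨1 * τ * 1⁻¹, hmem⟩ = Φ.1 τ := by
    change Φ.1 (1 * τ * 1⁻¹) = Φ.1 τ
    simp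
  rw [e1, inv_one, map_one, one_apply_eq_self, sub_eq_zero] at h
  exact h

end Extraction

end Summit.BirchSwinnertonDyer.BirchSwinnertonDyer.Theorems.KimAtThreeD7uRefined

end
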